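import Summits.Ventures.PercRepro2.CaseOneStarCertT1
import Summits.Ventures.PercRepro2.CaseOneGadgetUWA1BBlockI0
import Summits.Ventures.PercRepro2.CaseOneGadgetUWA1BBlockI1
import Summits.Ventures.PercRepro2.CaseOneGadgetUWA1BBlockI2
import Summits.Ventures.PercRepro2.CaseOneGadgetUWA1BBlockI3
import Summits.Ventures.PercRepro2.CaseOneGadgetUWA1BBlockI4
import Summits.Ventures.PercRepro2.CaseOneGadgetUWA1BBlockI5
import Summits.Ventures.PercRepro2.CaseOneGadgetUWA1BBlockI6
import Summits.Ventures.PercRepro2.CaseOneGadgetUWA1BBlockI7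
import Summits.Ventures.PercRepro2.CaseOneGadgetUWA1BBlockI8
import Summits.Ventures.PercRepro2.CaseOneGadgetUWA1BBlockI9
import Summits.Ventures.PercRepro2.CaseOneGadgetUWA1BBlockI10
import Summits.Ventures.PercRepro2.CaseOneGadgetUWA1BBlockI11
import Summits.Ventures.PercRepro2.CaseOneGadgetUWA1BBlockI12
import Summits.Ventures.PercRepro2.CaseOneGadgetUWA1BBlockI13
import Summits.Ventures.PercRepro2.CaseOneGadgetUWA1BBlockI14
import Summits.Ventures.PercRepro2.CaseOneStarFactsB

/-!
# The gadget `u ~ {w, a₁, b}`, `w ~ {u, a₂, o}` (uwa1b): the cell certificates of `iAB5` (part 24c)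
(blind cell PercRepro2, p1 g34; the fourth gadget anchor of the six-form calculus — all six forms of the uwa1b gadget
as plain SFacts-cone certificate chains, generated by mining/p1/g34/uwa1b/genu.py = p1 g33's gent_uwa1.py / g25's
geno.py re-targeted; P1-G33 §6–§6″, P1-G34)

Each `eBABI ijk kl` is a nonnegative combination of `(pairwise atom) × (cell)` and cubic cell monomials — or, for the degree-4 ones, `M × eBABI ijk kl` (`M = Σ cᵢ` the total cell mass) is a nonnegative combination of `(atom) × (cell) × (cell)` and quartic cell monomials, then `SFacts.nonneg_of_sum_mul` (`CaseOneStarCertT1`) — exact LP certificates (kit j319447, every certificate re-verified exactly; data/p1/g33/gcerts_i_uwa1b.json, form `i`), here as exact `linear_combination`s over `SFacts` (the rational coefficients cleared by their common denominator). -/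

namespace Summit.Ventures.PercRepro2

namespace CaseOne

section CertABI24c
variable {R : Type*} [Field R] [LinearOrder R] [IsStrictOrderedRing R]

set_option maxHeartbeats 0 in
/-- `eBABI13321 ≥ 0`: the combination is identically zero (`ring`). -/
lemma eBABI13321_nonneg (m : SCells R) (_hf : SFactsB m) : 0 ≤ eBABI13321 m := by
  have h : eBABI13321 m = 0 := by
    unfold eBABI13321 cBABI00121 cBABI00221 cBABI01021 cBABI01121 cBABI01221 cBABI01321 cBABI02021 cBABI02121 cBABI02221 cBABI02321 cBABI03121 cBABI03221 cBABI03321 cBABI10021 cBABI10121 cBABI10221 cBABI10321 cBABI11021 cBABI11121 cBABI11221 cBABI11321 cBABI12021 cBABI12121 cBABI12221 cBABI12321 cBABI13021 cBABI13121 cBABI13221 cBABI13321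
    ring
  linarith [h]

set_option maxHeartbeats 0 in
/-- `eBABI13322 ≥ 0`: the combination is identically zero (`ring`). -/
lemma eBABI13322_nonneg (m : SCells R) (_hf : SFactsB m) : 0 ≤ eBABI13322 m := by
  have h : eBABI13322 m = 0 := by
    unfold eBABI13322 cBABI00122 cBABI00222 cBABI01022 cBABI01122 cBABI01222 cBABI01322 cBABI02022 cBABI02122 cBABI02222 cBABI02322 cBABI03122 cBABI03222 cBABI03322 cBABI10022 cBABI10122 cBABI10222 cBABI10322 cBABI11022 cBABI11122 cBABI11222 cBABI11322 cBABI12022 cBABI12122 cBABI12222 cBABI12322 cBABI13022 cBABI13122 cBABI13222 cBABI13322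
    ring
  linarith [h]

end CertABI24c

end CaseOne

end Summit.Ventures.PercRepro2
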